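/-
Copyright (c) 2026 the pub-hodgecm-mathlib formalisation cell (harness21).  Prover seat hodgecm-mathlib-K2E3-p01 (g0), Track B ∕ K2-LIT
(build stream 29), h413 = `stmt-HodgeConjecture-24833`, line `K2_E3_EllipticInputs`, socket module «U3CubicGerms» U3-a, file #1 — the payment of
`K2E3EllipticInputs.U3CubicGerms.sig_K2E3CubicTorusTypeThreeExists` TOKEN FOR TOKEN.  2026-09-03.
-/
import Literature.NumberTheory.Rogawski1990.TypeThreeCubicTorusCartan      -- ★ `TypeThreeTorus.exists_typeThree_cartan_elliptic_gqs` (the elliptic Cartan of type (3) in `Gqs L v`)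
import Literature.NumberTheory.Automorphic.AdelicSecondCountable           -- ★ `secondCountableTopology_adicCompletion`, ★ `countable_heightOneSpectrum`
import Mathlib.Topology.Sequences                                          -- `mem_closure_iff_seq_limit`
import HarnessLib

/-!
# h413 ∕ Track B «K2-LIT», line `K2_E3_EllipticInputs`, socket module «U3CubicGerms» U3-a: A COMPACT CARTAN SUBGROUP OF TYPE (3) IN `U(Φ₃)(L⁺_v)`
# (payment of `Cruxes/H413/Lines/K2_E3_EllipticInputsSigs_U3CubicGerms.lean :: sig_K2E3CubicTorusTypeThreeExists`, statement bytes frozen)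

Cell `pub/hodgecm-mathlib`, crux H413 = `stmt-HodgeConjecture-24833`, route of record `HCCMUnconditional`; chair K2-lead (g0), dealer K2E3-plan (g0),
EMIT «SKELETON LANDED K2E3» (REQUESTS l.72411) file #1 `sig_K2E3CubicTorusTypeThreeExists` (SIGS-TABLE row #1, unit U3, size «L») ↦ seat K2E3-p01.
THEOREMS ONLY (no `def`, no `instance`, no `notation`, no named-fact hypothesis, no `sorry`); imports = ★ Literature + Mathlib + HarnessLib (never
`Cruxes/…/Lines`); lane `--supports stmt-HodgeConjecture-24833 --as helper` (it pays one socket of the K2E3 skeleton; by itself it moves no counter).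

THE STATEMENT (bytes of the socket; the Lines-side reducible `abbrev Pl L := HeightOneSpectrum (𝓞 L⁺)` inlined).  For every CM field `L` and every
finite place `v` of `L⁺` that does NOT split in `L` (every `w ∣ v` is fixed by complex conjugation) there is a subgroup `T ≤ Gqs L v = U(Φ₃)(L⁺_v)`
(★ `Rogawski1990.Gqs`, the quasi-split unitary group in three variables at `v`, a subgroup of `GL₃(∏_{w∣v} L_w)`) which is
(i) COMPACT; (ii) the CENTRALISER of one of its regular elements `γ₀` (★ `Rogawski1990.IsRegularElt`: separable characteristic polynomial);
(iii) such that every regular `γ ∈ T` has a characteristic polynomial WITHOUT ROOTS in `∏_{w∣v} L_w` (no eigenvalue in `E = L_w`: type (3));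
(iv) and in which `1` is the limit of a SEQUENCE of regular elements.  This is [Rogawski1990, §3.6 p. 31] «Type (3): `T_L` where `L∕F` is a cubic
extension» — an elliptic Cartan subgroup attached to a cubic extension of `F = L⁺_v` — in the form the germ-residue stub 3 of the line consumes.

THE PROOF (strategy: REUSE, then one topological glue step).  The tree already holds the whole construction:
★ `Literature.NumberTheory.Rogawski1990.TypeThreeTorus.exists_typeThree_cartan_elliptic_gqs` (file `TypeThreeCubicTorusCartan`, sequel of
`TypeThreeCubicTorusAlgebra`∕`…Nonsplit`) builds, at a non-split `v`, the torus `T = {M(p,q,r) = p + qC_a + rC_a² unitary}` of the Kummer companion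
matrix `C_a` of `x³ − a`, `a = ϖ·σ_w ϖ` (not a cube in `L_w`), and proves: `T` abelian; regular elements of `T` have root-free characteristic polynomials;
«for every `U ∈ 𝓝 1` some regular `γ ∈ T` lies in `U`»; `Z(γ) = T` for every regular `γ ∈ T`; `T` compact.  Clauses (i)–(iii) are read off
(a regular `γ₀ ∈ T` exists by the accumulation clause at `U = univ`, and then `T = Z(γ₀)`).  Clause (iv) asks for a SEQUENCE, i.e. sequential closure:
§1 proves that the local unitary groups `U(J)(F_v) ≤ GL_N(∏_{w∣v} E_w)` are FIRST COUNTABLE (each `E_w` is second countable ★, the fibre `{w ∣ v}` is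
countable ★, matrices∕`Mᵐᵒᵖ`∕units∕subtypes inherit first countability — the template of ★ `Weil1964.firstCountableTopology_unitaryGroup_adelic`), so
`1 ∈ closure {γ ∈ T regular}` yields the sequence by Mathlib's `mem_closure_iff_seq_limit` (first countable ⇒ Fréchet–Urysohn).

* §1 `firstCountableTopology_localRing` · `firstCountableTopology_unitaryGroup_local` · `firstCountableTopology_gqs` (topological glue, generic `E∕F`, `c`, `N`, `J`);
* §2 `exists_seq_tendsto_one_of_forall_nhds` (a sequence in `S` tending to `1` from «every neighbourhood of `1` meets `S`», first countable groups);
* §3 **`CubicTorusTypeThreeExists`** · `sig_K2E3CubicTorusTypeThreeExists` TOKEN FOR TOKEN (tie probe at home once the socket module is built on stream 29: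
  `example : type_of% @CubicTorusTypeThreeExists = type_of% @K2E3EllipticInputs.U3CubicGerms.sig_K2E3CubicTorusTypeThreeExists := rfl`,
  file `K2/K2E3-p01/g0/Probe_K2E3CubicTorusTypeThreeExists.lean`).

WHAT IS NOT HERE.  The germ expansion and its residue along `T` (U3-b, U3-c: other files of the unit); the unramified cubic torus (the ★ construction uses the
RAMIFIED Kummer parameter `a = ϖ σ_w ϖ`, `v_w(a) = 2`, which serves at every residue characteristic including `3` and `2` — the socket only asks for SOME
type-(3) Cartan subgroup); second countability ∕ metrisability of `Gqs L v` (not needed).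

HONEST LABEL.  HC_CM is proved only modulo the 7 printed citations (2 remaining named inputs: hLiu418 = `stmt-HodgeConjecture-24832`, h413 =
`stmt-HodgeConjecture-24833`) until rung 0 closes; this file pays one socket of the K2E3 skeleton and proves no printed letter by itself.

## References
* [Rogawski1990] J. D. Rogawski, *Automorphic Representations of Unitary Groups in Three Variables*, Ann. of Math. Stud. 123 (1990), §3.1 p. 19
  (regular elements, Cartan subgroups), §3.6 p. 31 (types (0)–(3)), §12.7 p. 194 (use of a type-(3) torus in the germ expansion).
* [PlatonovRapinchuk1994] V. Platonov, A. Rapinchuk, *Algebraic Groups and Number Theory* (1994), §6.4 Prop. 6.15 (anisotropic tori over local fields are compact).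
* [CasselsFrohlichANT1967] J. W. S. Cassels, A. Fröhlich (eds.), *Algebraic Number Theory* (1967), Ch. II §10–§11 (`E ⊗_F F_v = ∏_{w∣v} E_w`, finitely many `w ∣ v`).
-/

set_option autoImplicit false
-- the mandated namespace repeats the single-problem summit's segment (`HodgeConjecture.HodgeConjecture`), as in every `Theorems/*.lean` of this sub-problem
set_option linter.dupNamespace false

noncomputable section

open NumberField IsDedekindDomain Filter Topology
open scoped Matrix MatrixGroups
open Literature.NumberTheory.Rogawski1990 Literature.NumberTheory.Automorphic Literature.NumberTheory.Automorphic.UnitaryGroup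

namespace Summit.HodgeConjecture.HodgeConjecture.Cruxes.H413.K2E3CubicTorusTypeThreeExists

/-! ## §1 The local unitary groups `U(J)(F_v) ≤ GL_N(∏_{w∣v} E_w)` are first countable -/

section FirstCountable

variable {F : Type} [Field F] [NumberField F] (E : Type) [Field E] [NumberField E] [Algebra F E]
  (c : E ≃ₐ[F] E) (N : ℕ) (J : Matrix (Fin N) (Fin N) E) (v : HeightOneSpectrum (𝓞 F))

omit [NumberField F] in
/-- **`E_v = ∏_{w∣v} E_w` is first countable**: each completion `E_w` of the number field `E` is second countable
(★ `secondCountableTopology_adicCompletion`) and the fibre `{w ∣ v}` is countable (a subtype of the countable `HeightOneSpectrum (𝓞 E)`,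
★ `countable_heightOneSpectrum`), so the product topology is first countable.  [cite: CasselsFrohlichANT1967, Ch. II §10–§11] -/
theorem firstCountableTopology_localRing : FirstCountableTopology (UnitaryGroup.LocalRing E v) := by
  haveI : Countable (HeightOneSpectrum (𝓞 E)) := countable_heightOneSpectrum E
  haveI : ∀ w : PlacesOver E v, SecondCountableTopology (w.1.adicCompletion E) :=
    fun w => secondCountableTopology_adicCompletion E w.1
  exact inferInstanceAs (FirstCountableTopology ((w : PlacesOver E v) → w.1.adicCompletion E))

/-- **The local unitary group `U(J)(F_v) ≤ GL_N(E_v)` is first countable**: `GL_N(E_v)` carries the topology induced by the embedding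
`g ↦ (g, g⁻¹)` into `M_N(E_v) × M_N(E_v)ᵐᵒᵖ` (Mathlib `Units.isInducing_embedProduct`), matrices are a finite product of copies of the first countable
`E_v` (`firstCountableTopology_localRing`), and subgroups carry the induced topology — the finite-place twin of ★
`Weil1964.firstCountableTopology_unitaryGroup_adelic`.  [cite: CasselsFrohlichANT1967, Ch. II §10–§11] -/
theorem firstCountableTopology_unitaryGroup_local : FirstCountableTopology ↥(UnitaryGroup.«local» E c N J v) := by
  haveI h0 : FirstCountableTopology (UnitaryGroup.LocalRing E v) := firstCountableTopology_localRing E v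
  haveI h1 : FirstCountableTopology (Matrix (Fin N) (Fin N) (UnitaryGroup.LocalRing E v)) :=
    inferInstanceAs (FirstCountableTopology (Fin N → Fin N → UnitaryGroup.LocalRing E v))
  haveI h2 : FirstCountableTopology (Matrix (Fin N) (Fin N) (UnitaryGroup.LocalRing E v))ᵐᵒᵖ :=
    (MulOpposite.opHomeomorph (M := Matrix (Fin N) (Fin N) (UnitaryGroup.LocalRing E v))).symm.isInducing.firstCountableTopology
  haveI h3 : FirstCountableTopology (GL (Fin N) (UnitaryGroup.LocalRing E v)) :=
    Units.isInducing_embedProduct.firstCountableTopology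
  exact Topology.IsInducing.subtypeVal.firstCountableTopology

end FirstCountable

/-- **`Gqs L v = U(Φ₃)(L⁺_v)` is first countable** (★ `cmDatum_Local` is `rfl`: the carrier of `Gqs L v` is the local unitary group
`UnitaryGroup.«local» L c 3 Φ₃ v`, first countable by `firstCountableTopology_unitaryGroup_local`).  [cite: Rogawski1990, §3.1 p. 19] -/
theorem firstCountableTopology_gqs (L : Type) [Field L] [NumberField L] [IsCMField L] (v : HeightOneSpectrum (𝓞 ↥(maximalRealSubfield L))) :
    FirstCountableTopology (Gqs L v) :=
  firstCountableTopology_unitaryGroup_local L (IsCMField.complexConj L) 3 (qsForm L) v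

/-! ## §2 From «every neighbourhood of `1` meets `S`» to a sequence in `S` tending to `1` -/

/-- In a first countable topological space, if every neighbourhood of a point `x` meets a set `S`, then some SEQUENCE of elements of `S` tends to `x`
(`x ∈ closure S`, and first countable spaces are Fréchet–Urysohn: Mathlib `mem_closure_iff_seq_limit`).  [folklore] -/
theorem exists_seq_tendsto_of_forall_nhds {X : Type*} [TopologicalSpace X] [FirstCountableTopology X] {x : X} {S : Set X}
    (h : ∀ U ∈ 𝓝 x, ∃ y ∈ S, y ∈ U) : ∃ u : ℕ → X, (∀ n, u n ∈ S) ∧ Tendsto u atTop (𝓝 x) := by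
  have hx : x ∈ closure S := by
    rw [mem_closure_iff_nhds]
    intro U hU
    obtain ⟨y, hyS, hyU⟩ := h U hU
    exact ⟨y, hyU, hyS⟩
  exact mem_closure_iff_seq_limit.mp hx

/-! ## §3 The socket `sig_K2E3CubicTorusTypeThreeExists`, token for token -/

/-- **FILE `K2E3CubicTorusTypeThreeExists` — A COMPACT CARTAN SUBGROUP OF TYPE (3) IN `G_v = U(Φ₃)(L⁺_v)` AT A NON-SPLIT PLACE**
(`K2E3EllipticInputs.U3CubicGerms.sig_K2E3CubicTorusTypeThreeExists` TOKEN FOR TOKEN, the Lines-side `abbrev Pl L` inlined).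
Printed: [Rogawski1990, §3.6 p. 31] «It is convenient to classify the Cartan subgroups of G according to four types … Type (3): `T_L` where `L∕F`
is a cubic extension».  For `v` non-split in the CM field `L` there is `T ≤ Gqs L v` with: `T` COMPACT; `T = Z(γ₀)` for a REGULAR `γ₀` (the
centraliser of one of its regular elements); every regular `γ ∈ T` has a characteristic polynomial with NO ROOT in `∏_{w∣v} L_w` (no eigenvalue in
`E = L_w`); and `1 = lim γ_n` for a sequence of regular `γ_n ∈ T`.  Proof: the torus of ★ `TypeThreeTorus.exists_typeThree_cartan_elliptic_gqs`
(the norm-one group of the cubic Kummer algebra `L_w[x]∕(x³ − ϖσ_wϖ)` inside `U(Φ₃)`, [Rogawski1990] §3.6 type (3); compact by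
[PlatonovRapinchuk1994] §6.4); a regular `γ₀ ∈ T` from its accumulation clause at `U = univ`, `T = Z(γ₀)` from its Cartan clause; the sequence from the
accumulation clause by `exists_seq_tendsto_of_forall_nhds` in the first countable group `Gqs L v` (`firstCountableTopology_gqs`).
[cite: Rogawski1990, §3.6 p. 31; §3.1 p. 19; §12.7 p. 194] [cite: PlatonovRapinchuk1994, §6.4 Prop. 6.15] -/
theorem CubicTorusTypeThreeExists :
  ∀ (L : Type) [Field L] [NumberField L] [IsCMField L] (v : HeightOneSpectrum (𝓞 ↥(maximalRealSubfield L))),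
    (∀ w : PlacesOver L v, IsCMField.complexConj L • w.1 = w.1) →
    ∃ T : Subgroup (Gqs L v), IsCompact ((T : Subgroup (Gqs L v)) : Set (Gqs L v)) ∧
        (∃ γ₀ : Gqs L v, IsRegularElt (γ₀.val : GL (Fin 3) (UnitaryGroup.LocalRing L v)) ∧ T = Subgroup.centralizer ({γ₀} : Set (Gqs L v))) ∧
        (∀ γ ∈ T, IsRegularElt (γ.val : GL (Fin 3) (UnitaryGroup.LocalRing L v)) → ∀ c : UnitaryGroup.LocalRing L v, ¬ ((γ.val.val : Matrix (Fin 3) (Fin 3) (UnitaryGroup.LocalRing L v)).charpoly).IsRoot c) ∧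
        (∃ γseq : ℕ → Gqs L v, (∀ n, γseq n ∈ T ∧ IsRegularElt ((γseq n).val : GL (Fin 3) (UnitaryGroup.LocalRing L v))) ∧ Tendsto γseq atTop (𝓝 1)) := by
  intro L _ _ _ v hns
  obtain ⟨T, -, hroot, -, hacc, hcart, hcpt⟩ := TypeThreeTorus.exists_typeThree_cartan_elliptic_gqs L v hns
  -- a regular element of `T` (accumulation at `U = univ`), of which `T` is the centraliser (Cartan clause)
  obtain ⟨γ₀, hγ₀T, -, hγ₀reg⟩ := hacc Set.univ Filter.univ_mem
  -- the sequence of regular elements of `T` tending to `1` (first countability of `Gqs L v`)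
  haveI : FirstCountableTopology (Gqs L v) := firstCountableTopology_gqs L v
  obtain ⟨γseq, hmem, hlim⟩ := exists_seq_tendsto_of_forall_nhds
    (S := {γ : Gqs L v | γ ∈ T ∧ IsRegularElt (γ.val : GL (Fin 3) (UnitaryGroup.LocalRing L v))}) (x := (1 : Gqs L v))
    (fun U hU => by
      obtain ⟨γ, hγT, hγU, hreg⟩ := hacc U hU
      exact ⟨γ, ⟨hγT, hreg⟩, hγU⟩)
  exact ⟨T, hcpt, ⟨γ₀, hγ₀reg, (hcart γ₀ hγ₀T hγ₀reg).symm⟩, hroot, γseq, hmem, hlim⟩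

end Summit.HodgeConjecture.HodgeConjecture.Cruxes.H413.K2E3CubicTorusTypeThreeExists

end
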